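import Summits.BirchSwinnertonDyer.BirchSwinnertonDyer.Theses.TameQuarticManinParity
import Summits.BirchSwinnertonDyer.BirchSwinnertonDyer.Theorems.TameQuarticManinParityTameThreeOfColength
import HarnessLib

/-!
# Route `TameQuarticManinParity`, LINE 48 glue G48 `StarredCongruenceDepthOfALDepth` (stmt-BirchSwinnertonDyer-24794):
# `ALStableThreeCuspRegular → TprimeStarredALDepth → TprimeStarredNeronCongruenceDepth`, BY NAME

Verbatim landing (leaf hand `leafhand-bsd-tamequarticmaninpa-1-g0`, cone of the cruxes 23736/23737) of the planner-of-record's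
kernel-checked glue (bsd-idea-3 g13, HOME `ideators/bsd-idea-3/ideas/l48/Sketch48.lean` sha16 ce13ba008de125db, theorem
`starredCongruenceDepth_of_alDepth`, 2026-08-29; there stated against shadow defs, here against the rendered route decls).
Proof, as in the item's docstring: take the AL-stable integral witness `h` of depth `δ` (AR48); `g := 3·h` is rational and
cusp-regular (AL48, at `v₃ N = 2` by `padicValNat_conductorNorm_eq_two_of_subTprime`); `⟨f, g⟩ = 3t⟨f, f⟩`
(`peterssonProduct_smul_right`) with `3t ≠ 0` and `v₃(3t) + v₃(deg φ) = 1 + v₃(t) + v₃(deg φ) ≤ 1`.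
Glue only: AL48 (24792), AR48 (24793), N42*′ (24103), E57′ (24046) and every crux above stay OPEN; BSD is NOT proved.
-/

set_option autoImplicit false
-- D-0017: single-problem summit, so `Summit.BirchSwinnertonDyer.BirchSwinnertonDyer.…` repeats a namespace BY DESIGN.
set_option linter.dupNamespace false

open Summit.BirchSwinnertonDyer.BirchSwinnertonDyer.Theses.TameQuarticManinParity
open Literature.NumberTheory.EllipticCurves.ModularForms CongruenceSubgroup

namespace Summit.BirchSwinnertonDyer.BirchSwinnertonDyer.Theorems.TameQuarticManinParity

/-- **G48 (stmt-BirchSwinnertonDyer-24794) by name**: `ALStableThreeCuspRegular → TprimeStarredALDepth →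
TprimeStarredNeronCongruenceDepth` — from the AL-stable integral depth witness `h` (AR48) the form `g = 3h` is rational and
cusp-regular (AL48) and `⟨f, g⟩ = 3t·⟨f, f⟩` with `3t ≠ 0`, `v₃(3t) + v₃(deg φ) ≤ 1`. [folklore] -/
theorem starredCongruenceDepthOfALDepth_proof : StarredCongruenceDepthOfALDepth := by
  unfold StarredCongruenceDepthOfALDepth
  intro hAL hAR W _ _ _ hadd hsub hdisc D hlat hopt
  obtain ⟨M, hMint, hMal, h, hhM, t, ht0, htv, hth⟩ := hAR W hadd hsub hdisc D hlat hopt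
  have hv2 : padicValNat 3 (W.conductorNorm ℤ) = 2 :=
    padicValNat_conductorNorm_eq_two_of_subTprime W hsub
  obtain ⟨g, hgq, hgreg, hg3⟩ := hAL (W.conductorNorm ℤ) hv2 M hMint hMal h hhM
  refine ⟨g, hgq, hgreg, 3 * t, mul_ne_zero three_ne_zero ht0, ?_, ?_⟩
  · rw [padicValRat.mul three_ne_zero ht0]
    have h3 : padicValRat 3 (3 : ℚ) = 1 := by exact_mod_cast padicValRat.self (p := 3) (by norm_num)
    rw [h3]; push_cast at htv ⊢; linarith
  · rw [hg3, peterssonProduct_smul_right, hth]; push_cast; ring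

end Summit.BirchSwinnertonDyer.BirchSwinnertonDyer.Theorems.TameQuarticManinParity
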